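import Mathlib
import Literature.Analysis.FluidPDE.SelfSimilar
import Literature.Analysis.FluidPDE.SteadyLiouvilleCriteria
import Literature.Analysis.FluidPDE.SteadyLiouvilleTsaiEnergy
import Literature.Analysis.FunctionSpaces.WeakLp
import Literature.Analysis.FunctionSpaces.WeakLpQuantitative
import HarnessLib

/-!
# Weak-`L³` steady Liouville: a `C²` steady Navier–Stokes solution on `ℝ³` with `U ∈ L^{3,∞}` vanishes

Records-grade derivation (ns-claims C178 `Nahiru2026`, second refuter): the CLAIMED statement of
the row (Thm 1.1: smooth stationary NS on `ℝ³`, `‖v‖_{L^{3,∞}} < ∞ ⇒ v ≡ 0`) follows from the tree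
theorem `Tsai2021_annular_liouville_holds` (Tsai 2021, Thm 1.1 (a)) at `δ = 1`, `L = 2`, and the
weak-`L^p` layer-cake bound `MemWeakLp.setLIntegral_rpow_le` (`p = 3`, `r = 12/5`, height `λ = R⁻¹`):
`∫_{R<|x|<2R} |U|^{12/5} ≤ |B_{2R}| R^{-12/5} + 4 R^{3/5} W = R^{3/5} (8|B₁| + 4W)`,
`W = sup_t t³ |{|U|>t}|`, so Tsai's quantity `R⁻¹ ‖U‖²_{L^{12/5}(R<|x|<2R)} ≤ (8|B₁|+4W)^{5/6} R^{-1/2} → 0`.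
In print: Seregin–Wang, St. Petersburg Math. J. 31 (2020), Thm 1.1 (ii) (`12/5 < q < 3`);
Tsai, SN PDE 2 (2021), Thm 1.1 (a). No new definitions, no named facts.
-/

noncomputable section

namespace Literature.Analysis.FluidPDE.WeakL3SteadyLiouville

open MeasureTheory Set Metric Filter Topology Module
open scoped ENNReal
open Literature.Analysis.FluidPDE Literature.Analysis.FunctionSpaces

/-- Real-exponent bookkeeping: `(2R)³ · (R⁻¹)^{12/5} = 8 R^{3/5}` for `R > 0`. [folklore] -/
private theorem two_mul_pow_three_mul_inv_rpow {R : ℝ} (hR : 0 < R) :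
    (2 * R) ^ 3 * (R⁻¹) ^ (12 / 5 : ℝ) = 8 * R ^ (3 / 5 : ℝ) := by
  have h3 : R ^ 3 = R ^ (12 / 5 : ℝ) * R ^ (3 / 5 : ℝ) := by
    rw [← Real.rpow_add hR, show (12 / 5 : ℝ) + 3 / 5 = ((3 : ℕ) : ℝ) by norm_num, Real.rpow_natCast]
  have hpos : 0 < R ^ (12 / 5 : ℝ) := Real.rpow_pos_of_pos hR _
  rw [Real.inv_rpow hR.le, mul_pow, h3]
  field_simp
  ring

/-- Real-exponent bookkeeping: `(12/5)/(3 − 12/5) · (R⁻¹)^{12/5 − 3} = 4 R^{3/5}` for `R > 0`. [folklore] -/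
private theorem coeff_mul_inv_rpow_sub {R : ℝ} (hR : 0 < R) :
    (12 / 5 : ℝ) / (3 - 12 / 5) * (R⁻¹) ^ ((12 / 5 : ℝ) - 3) = 4 * R ^ (3 / 5 : ℝ) := by
  rw [show ((12 / 5 : ℝ) - 3) = -(3 / 5 : ℝ) by norm_num, Real.rpow_neg (inv_nonneg.2 hR.le),
    Real.inv_rpow hR.le, inv_inv]
  norm_num

/-- **Weak-`L³` layer cake on the Tsai annulus** (`δ = 1`: exponent `6(3−1)/(6−1) = 12/5`): for
`U` a.e.-strongly measurable with `W = eWeakLpPow U 3 volume < ∞` and `R > 0`,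
`∫_{R<|x|<2R} ‖U‖^{12/5} ≤ ofReal (R^{3/5} (8|B₁| + 4W))`. [folklore] -/
private theorem setLIntegral_annulus_le {U : EuclideanSpace ℝ (Fin 3) → EuclideanSpace ℝ (Fin 3)}
    (hU : MemWeakLp U 3 volume) {R : ℝ} (hR : 0 < R) :
    ∫⁻ x in {x : EuclideanSpace ℝ (Fin 3) | R < ‖x‖ ∧ ‖x‖ < 2 * R},
        ‖U x‖ₑ ^ (6 * (3 - 1) / (6 - 1) : ℝ) ≤
      ENNReal.ofReal (R ^ (3 / 5 : ℝ) *
        (8 * (volume (ball (0 : EuclideanSpace ℝ (Fin 3)) 1)).toReal +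
          4 * (eWeakLpPow U 3 volume).toReal)) := by
  have hq : (6 * (3 - 1) / (6 - 1) : ℝ) = 12 / 5 := by norm_num
  rw [hq]
  set S : Set (EuclideanSpace ℝ (Fin 3)) := {x | R < ‖x‖ ∧ ‖x‖ < 2 * R} with hS
  set v : ℝ := (volume (ball (0 : EuclideanSpace ℝ (Fin 3)) 1)).toReal with hv
  set w : ℝ := (eWeakLpPow U 3 volume).toReal with hw
  have hv0 : 0 ≤ v := ENNReal.toReal_nonneg
  have hw0 : 0 ≤ w := ENNReal.toReal_nonneg
  have hballfin : volume (ball (0 : EuclideanSpace ℝ (Fin 3)) 1) ≠ ⊤ := measure_ball_lt_top.ne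
  have hWfin : eWeakLpPow U 3 volume ≠ ⊤ := hU.2.ne
  -- the layer-cake bound at height `λ = R⁻¹`
  have h := MemWeakLp.setLIntegral_rpow_le (p := 3) (μ := volume) hU.1 (r := 12 / 5)
    (by norm_num) (by rw [ENNReal.toReal_ofNat]; norm_num) S (inv_pos.2 hR)
  rw [ENNReal.toReal_ofNat] at h
  -- the annulus sits in `B_{2R}`
  have hvol : volume S ≤ ENNReal.ofReal ((2 * R) ^ 3) * volume (ball (0 : EuclideanSpace ℝ (Fin 3)) 1) := by
    calc volume S ≤ volume (ball (0 : EuclideanSpace ℝ (Fin 3)) (2 * R)) :=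
          measure_mono fun x hx => mem_ball_zero_iff.2 hx.2
      _ = _ := by rw [Measure.addHaar_ball _ _ (by positivity), finrank_euclideanSpace_fin]
  refine h.trans ?_
  have hvE : volume (ball (0 : EuclideanSpace ℝ (Fin 3)) 1) = ENNReal.ofReal v := by
    rw [hv, ENNReal.ofReal_toReal hballfin]
  have hwE : eWeakLpPow U 3 volume = ENNReal.ofReal w := by
    rw [hw, ENNReal.ofReal_toReal hWfin]
  have hl1 : 0 ≤ (R⁻¹) ^ (12 / 5 : ℝ) := Real.rpow_nonneg (inv_nonneg.2 hR.le) _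
  have hl2 : 0 ≤ (12 / 5 : ℝ) / (3 - 12 / 5) * (R⁻¹) ^ ((12 / 5 : ℝ) - 3) :=
    mul_nonneg (by norm_num) (Real.rpow_nonneg (inv_nonneg.2 hR.le) _)
  calc volume S * ENNReal.ofReal ((R⁻¹) ^ (12 / 5 : ℝ)) +
        ENNReal.ofReal ((12 / 5 : ℝ) / (3 - 12 / 5) * (R⁻¹) ^ ((12 / 5 : ℝ) - 3)) * eWeakLpPow U 3 volume
      ≤ ENNReal.ofReal ((2 * R) ^ 3) * volume (ball (0 : EuclideanSpace ℝ (Fin 3)) 1) *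
          ENNReal.ofReal ((R⁻¹) ^ (12 / 5 : ℝ)) +
        ENNReal.ofReal ((12 / 5 : ℝ) / (3 - 12 / 5) * (R⁻¹) ^ ((12 / 5 : ℝ) - 3)) *
          eWeakLpPow U 3 volume := by
        gcongr
    _ = ENNReal.ofReal ((2 * R) ^ 3 * v * (R⁻¹) ^ (12 / 5 : ℝ) +
          (12 / 5 : ℝ) / (3 - 12 / 5) * (R⁻¹) ^ ((12 / 5 : ℝ) - 3) * w) := by
        rw [hvE, hwE, ← ENNReal.ofReal_mul (by positivity), ← ENNReal.ofReal_mul (by positivity),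
          ← ENNReal.ofReal_mul hl2, ← ENNReal.ofReal_add (by positivity) (mul_nonneg hl2 hw0)]
    _ = ENNReal.ofReal (R ^ (3 / 5 : ℝ) * (8 * v + 4 * w)) := by
        congr 1
        have e1 := two_mul_pow_three_mul_inv_rpow hR
        have e2 := coeff_mul_inv_rpow_sub hR
        calc (2 * R) ^ 3 * v * (R⁻¹) ^ (12 / 5 : ℝ) +
              (12 / 5 : ℝ) / (3 - 12 / 5) * (R⁻¹) ^ ((12 / 5 : ℝ) - 3) * w
            = ((2 * R) ^ 3 * (R⁻¹) ^ (12 / 5 : ℝ)) * v +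
                ((12 / 5 : ℝ) / (3 - 12 / 5) * (R⁻¹) ^ ((12 / 5 : ℝ) - 3)) * w := by ring
          _ = 8 * R ^ (3 / 5 : ℝ) * v + 4 * R ^ (3 / 5 : ℝ) * w := by rw [e1, e2]
          _ = R ^ (3 / 5 : ℝ) * (8 * v + 4 * w) := by ring

/-- **Tsai's `δ = 1` annular quantity of a weak-`L³` field is `O(R^{-1/2})`**: for `R > 0`,
`tsaiAnnulusQuantity 1 2 U R ≤ ofReal (R⁻¹ (R^{3/5} k)^{5/6})`, `k = 8|B₁| + 4W`. [folklore] -/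
private theorem tsaiAnnulusQuantity_le {U : EuclideanSpace ℝ (Fin 3) → EuclideanSpace ℝ (Fin 3)}
    (hU : MemWeakLp U 3 volume) {R : ℝ} (hR : 0 < R) :
    tsaiAnnulusQuantity 1 2 U R ≤
      ENNReal.ofReal (R⁻¹ * (R ^ (3 / 5 : ℝ) *
        (8 * (volume (ball (0 : EuclideanSpace ℝ (Fin 3)) 1)).toReal +
          4 * (eWeakLpPow U 3 volume).toReal)) ^ (5 / 6 : ℝ)) := by
  have hp : ((6 - 1) / 6 : ℝ) = 5 / 6 := by norm_num
  have hk : 0 ≤ 8 * (volume (ball (0 : EuclideanSpace ℝ (Fin 3)) 1)).toReal +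
      4 * (eWeakLpPow U 3 volume).toReal := by positivity
  have hA := setLIntegral_annulus_le hU hR
  unfold tsaiAnnulusQuantity
  rw [hp, ENNReal.ofReal_mul (inv_nonneg.2 hR.le), ← ENNReal.ofReal_inv_of_pos hR,
    ← ENNReal.ofReal_rpow_of_nonneg (mul_nonneg (Real.rpow_nonneg hR.le _) hk) (by norm_num)]
  gcongr

/-- The majorant `R⁻¹ (R^{3/5} k)^{5/6} = k^{5/6} R^{-1/2}` tends to `0` as `R → ∞` (`k ≥ 0`). [folklore] -/
private theorem tendsto_majorant {k : ℝ} (hk : 0 ≤ k) :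
    Tendsto (fun R : ℝ => R⁻¹ * (R ^ (3 / 5 : ℝ) * k) ^ (5 / 6 : ℝ)) atTop (𝓝 0) := by
  have h1 : Tendsto (fun R : ℝ => k ^ (5 / 6 : ℝ) * R ^ (-(1 / 2) : ℝ)) atTop (𝓝 0) := by
    simpa using (tendsto_rpow_neg_atTop (by norm_num : (0 : ℝ) < 1 / 2)).const_mul (k ^ (5 / 6 : ℝ))
  refine h1.congr' ?_
  filter_upwards [eventually_gt_atTop 0] with R hR
  have hR35 : 0 ≤ R ^ (3 / 5 : ℝ) := Real.rpow_nonneg hR.le _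
  rw [Real.mul_rpow hR35 hk, ← Real.rpow_mul hR.le, show (3 / 5 : ℝ) * (5 / 6) = 1 / 2 by norm_num,
    ← Real.rpow_neg_one R, show (-(1 / 2) : ℝ) = -1 + 1 / 2 by norm_num, Real.rpow_add hR]
  ring

/-- **Tsai's `δ = 1`, `L = 2` quantity of a weak-`L³` field tends to `0`** — the hypothesis of
Tsai 2021, Thm 1.1 (a) (`liminf_{R→∞} R⁻¹‖U‖²_{L^{12/5}(R<|x|<2R)} = 0`) holds for every
`U ∈ L^{3,∞}(ℝ³)`, by the weak-`L^p` layer cake (Seregin–Wang 2020, Thm 1.1 (ii) and the remark after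
it: the annular `L^q` norms, `12/5 ≤ q < 3`, of an `L^{3,∞}` field have the critical rate).
[cite: Tsai2021, Thm 1.1 (a) (hypothesis, verified for weak-L³ fields)] -/
theorem tendsto_tsaiAnnulusQuantity {U : EuclideanSpace ℝ (Fin 3) → EuclideanSpace ℝ (Fin 3)}
    (hU : MemWeakLp U 3 volume) : Tendsto (tsaiAnnulusQuantity 1 2 U) atTop (𝓝 0) := by
  have hk : 0 ≤ 8 * (volume (ball (0 : EuclideanSpace ℝ (Fin 3)) 1)).toReal +
      4 * (eWeakLpPow U 3 volume).toReal := by positivity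
  have hG : Tendsto (fun R : ℝ => ENNReal.ofReal (R⁻¹ * (R ^ (3 / 5 : ℝ) *
      (8 * (volume (ball (0 : EuclideanSpace ℝ (Fin 3)) 1)).toReal +
        4 * (eWeakLpPow U 3 volume).toReal)) ^ (5 / 6 : ℝ))) atTop (𝓝 0) := by
    rw [← ENNReal.ofReal_zero]
    exact ENNReal.tendsto_ofReal (tendsto_majorant hk)
  have hle : ∀ᶠ R in atTop, tsaiAnnulusQuantity 1 2 U R ≤
      ENNReal.ofReal (R⁻¹ * (R ^ (3 / 5 : ℝ) *
        (8 * (volume (ball (0 : EuclideanSpace ℝ (Fin 3)) 1)).toReal +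
          4 * (eWeakLpPow U 3 volume).toReal)) ^ (5 / 6 : ℝ)) := by
    filter_upwards [eventually_gt_atTop 0] with R hR
    exact tsaiAnnulusQuantity_le hU hR
  exact tendsto_of_tendsto_of_tendsto_of_le_of_le' tendsto_const_nhds hG
    (Eventually.of_forall fun _ => zero_le) hle

/-- **Weak-`L³` steady Liouville theorem** (Seregin–Wang 2020 Thm 1.1 (ii) / Tsai 2021 Thm 1.1 (a),
`δ = 1`): a `C²` steady Navier–Stokes solution `IsLerayProfile ν 0 U P` on `ℝ³` (any `ν > 0`) with
`U ∈ L^{3,∞}(ℝ³)` (`MemWeakLp U 3 volume`) is identically zero. No smallness, decay, boundedness or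
finite Dirichlet energy is assumed. [cite: Tsai2021, Thm 1.1 (a)] -/
theorem eq_zero_of_memWeakLp_three {ν : ℝ} (hν : 0 < ν)
    {U : EuclideanSpace ℝ (Fin 3) → EuclideanSpace ℝ (Fin 3)} {P : EuclideanSpace ℝ (Fin 3) → ℝ}
    (hprof : IsLerayProfile ν 0 U P) (hU : MemWeakLp U 3 volume) : U = 0 :=
  Tsai2021_annular_liouville_holds ν hν U P hprof 1 2 zero_le_one le_rfl one_lt_two
    (tendsto_tsaiAnnulusQuantity hU).liminf_eq

end Literature.Analysis.FluidPDE.WeakL3SteadyLiouville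

end
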